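import Summits.Ventures.HodgeRepro.CMType

/-!
# The subgroup `Δ ∪ cΔ` and coset representatives for `G ⧸ (Δ ∪ cΔ)`

Blind re-derivation cell `pub-hodge-repro`, seat `typer` (gen 8).  Continues typer's `CMType.lean`
(`IsComplexConj c`: `c` is a central involution).  Setup for `CosetKappa.lean` (the dimension `κ(Δ)` of
the `c`-odd functions with zero sum on every coset of a subgroup `Δ ∌ c`); nothing here is specific to
CM types.

* `conjExt hc Δ = Δ ∪ cΔ` — a subgroup because `c` is central (`mem_conjExt`, `le_conjExt`,
  `conj_mem_conjExt`); for `c ∉ Δ` the two pieces are disjoint (`not_conj_mul_mem`), so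
  `conjExt hc Δ ≃ Bool × Δ` (`conjExtEquiv`) and **`|Δ ∪ cΔ| = 2 |Δ|`** (`card_conjExt`).
* `cosetRep hc Δ x = ⟦x⟧.out`, the chosen representative of the coset `x (Δ ∪ cΔ)`:
  `(cosetRep x)⁻¹ x ∈ Δ ∪ cΔ` (`cosetRep_inv_mul_mem`), representatives are constant on cosets
  (`cosetRep_mul_of_mem`, `cosetRep_conj_mul`, `cosetRep_out_mul`), and `⟦c x⟧ = ⟦x⟧ = ⟦x d⟧` for
  `d ∈ Δ` (`mk_conj_mul`, `mk_mul_of_mem_sub`).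
-/

namespace HodgeRepro

/-! ### The subgroup `Δ ∪ cΔ` -/

section ConjExt

variable {G : Type*} [Group G]

/-- `conjExt hc Δ = Δ ∪ cΔ`: the subgroup generated by `Δ` and the central involution `c`. -/
def conjExt {c : G} (hc : IsComplexConj c) (Δ : Subgroup G) : Subgroup G where
  carrier := {x | x ∈ Δ ∨ c * x ∈ Δ}
  one_mem' := Or.inl Δ.one_mem
  mul_mem' := by
    rintro a b (ha | ha) (hb | hb)
    · exact Or.inl (Δ.mul_mem ha hb)
    · refine Or.inr ?_
      rw [← mul_assoc, hc.comm a, mul_assoc]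
      exact Δ.mul_mem ha hb
    · refine Or.inr ?_
      rw [← mul_assoc]
      exact Δ.mul_mem ha hb
    · refine Or.inl ?_
      have h : a * b = (c * a) * (c * b) := by
        rw [mul_assoc, ← mul_assoc a c b, ← hc.comm a, ← mul_assoc, ← mul_assoc, hc.mul_self, one_mul]
      rw [h]
      exact Δ.mul_mem ha hb
  inv_mem' := by
    rintro a (ha | ha)
    · exact Or.inl (Δ.inv_mem ha)
    · refine Or.inr ?_
      have h : c * a⁻¹ = (c * a)⁻¹ := by rw [mul_inv_rev, hc.inv_eq, hc.comm]
      rw [h]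
      exact Δ.inv_mem ha

variable {c : G} (hc : IsComplexConj c) {Δ : Subgroup G}

/-- Membership in `conjExt`. -/
theorem mem_conjExt {x : G} : x ∈ conjExt hc Δ ↔ x ∈ Δ ∨ c * x ∈ Δ := Iff.rfl

/-- `Δ ≤ conjExt hc Δ`. -/
theorem le_conjExt : Δ ≤ conjExt hc Δ := fun _ hx => Or.inl hx

/-- `c ∈ conjExt hc Δ`. -/
theorem conj_mem_conjExt : c ∈ conjExt hc Δ :=
  Or.inr (by rw [hc.mul_self]; exact Δ.one_mem)

/-- `c ∉ Δ`: the conjugate of an element of `Δ` is not in `Δ`. -/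
theorem not_conj_mul_mem (hcΔ : c ∉ Δ) {x : G} (hx : x ∈ Δ) : c * x ∉ Δ := by
  intro h
  apply hcΔ
  have := Δ.mul_mem h (Δ.inv_mem hx)
  rwa [mul_inv_cancel_right] at this

/-- `c ∉ Δ`: if the conjugate of `x` is in `Δ`, `x` is not. -/
theorem not_mem_of_conj_mul_mem (hcΔ : c ∉ Δ) {x : G} (hx : c * x ∈ Δ) : x ∉ Δ :=
  fun h => not_conj_mul_mem hcΔ h hx

/-- `conjExt hc Δ ≃ Bool × Δ` when `c ∉ Δ`: `x ↦ (false, x)` for `x ∈ Δ`, `x ↦ (true, c x)` otherwise. -/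
def conjExtEquiv [DecidablePred (· ∈ Δ)] (hcΔ : c ∉ Δ) : conjExt hc Δ ≃ Bool × Δ where
  toFun x :=
    if h : (x : G) ∈ Δ then (false, ⟨x, h⟩)
    else (true, ⟨c * x, ((mem_conjExt hc).mp x.2).resolve_left h⟩)
  invFun p := ⟨cond p.1 (c * p.2) p.2, by
    rcases p with ⟨b, d⟩
    cases b
    · exact Or.inl d.2
    · exact Or.inr (by rw [Bool.cond_true, hc.mul_mul_cancel]; exact d.2)⟩
  left_inv x := by
    by_cases h : (x : G) ∈ Δ
    · apply Subtype.ext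
      simp [h]
    · apply Subtype.ext
      simp [h, hc.mul_mul_cancel]
  right_inv p := by
    rcases p with ⟨b, d⟩
    cases b
    · simp
    · simp [not_conj_mul_mem hcΔ d.2, hc.mul_mul_cancel]

/-- `|Δ ∪ cΔ| = 2 |Δ|` when `c ∉ Δ`. -/
theorem card_conjExt [DecidablePred (· ∈ Δ)] (hcΔ : c ∉ Δ) :
    Nat.card (conjExt hc Δ) = 2 * Nat.card Δ := by
  rw [Nat.card_congr (conjExtEquiv hc hcΔ), Nat.card_prod, Nat.card_eq_fintype_card (α := Bool),
    Fintype.card_bool]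

/-! ### Coset representatives for `G ⧸ (Δ ∪ cΔ)` -/

variable (Δ)

/-- The representative (`Quotient.out`) of the coset `x · conjExt hc Δ`. -/
noncomputable def cosetRep (x : G) : G := (QuotientGroup.mk x : G ⧸ conjExt hc Δ).out

/-- `⟦cosetRep x⟧ = ⟦x⟧`. -/
theorem mk_cosetRep (x : G) :
    (QuotientGroup.mk (cosetRep hc Δ x) : G ⧸ conjExt hc Δ) = QuotientGroup.mk x :=
  QuotientGroup.out_eq' _

/-- `(cosetRep x)⁻¹ x ∈ Δ ∪ cΔ`. -/
theorem cosetRep_inv_mul_mem (x : G) : (cosetRep hc Δ x)⁻¹ * x ∈ conjExt hc Δ :=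
  QuotientGroup.eq.mp (mk_cosetRep hc Δ x)

/-- Representatives are constant on cosets: `cosetRep (y x) = cosetRep y` for `x ∈ Δ ∪ cΔ`. -/
theorem cosetRep_mul_of_mem (y : G) {x : G} (hx : x ∈ conjExt hc Δ) :
    cosetRep hc Δ (y * x) = cosetRep hc Δ y := by
  unfold cosetRep
  rw [QuotientGroup.mk_mul_of_mem y hx]

/-- `cosetRep (c x) = cosetRep x`. -/
theorem cosetRep_conj_mul (x : G) : cosetRep hc Δ (c * x) = cosetRep hc Δ x := by
  rw [hc.comm]
  exact cosetRep_mul_of_mem hc Δ x (conj_mem_conjExt hc)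

/-- `⟦c x⟧ = ⟦x⟧` in `G ⧸ (Δ ∪ cΔ)`. -/
theorem mk_conj_mul (x : G) :
    (QuotientGroup.mk (c * x) : G ⧸ conjExt hc Δ) = QuotientGroup.mk x := by
  rw [hc.comm]
  exact QuotientGroup.mk_mul_of_mem x (conj_mem_conjExt hc)

/-- `⟦x d⟧ = ⟦x⟧` in `G ⧸ (Δ ∪ cΔ)` for `d ∈ Δ`. -/
theorem mk_mul_of_mem_sub (x : G) {d : G} (hd : d ∈ Δ) :
    (QuotientGroup.mk (x * d) : G ⧸ conjExt hc Δ) = QuotientGroup.mk x :=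
  QuotientGroup.mk_mul_of_mem x (le_conjExt hc hd)

/-- `cosetRep (q.out d) = q.out` for `d ∈ Δ`. -/
theorem cosetRep_out_mul (q : G ⧸ conjExt hc Δ) {d : G} (hd : d ∈ Δ) :
    cosetRep hc Δ (q.out * d) = q.out := by
  unfold cosetRep
  rw [QuotientGroup.mk_mul_of_mem _ (le_conjExt hc hd), QuotientGroup.out_eq']

end ConjExt

end HodgeRepro
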